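import Literature.NumberTheory.GaloisCohomology.Howard2004.DualityDatumLocalCupAnnihilatorProofs
import Literature.NumberTheory.GaloisRepresentations.HomDualLocalPairingPlace
import Literature.NumberTheory.GaloisRepresentations.BrauerTower
import HarnessLib

/-!
# Injectivity of `H²(K_v, μ_n) → H²(K_v, μ_N)` on LOCAL classes (Kummer injectivity into `Br(K_v)`), and of Howard's value maps
# `H²(K_v, R₁(1)) → H²(K_v, R₂(1))` by character lifting (proofs)

`Proofs` file (theorems only; no definition, no named fact, no instance, no `sorry`).

For a number field `K`, a place `v` and `n ∣ N`, any morphism `f : μ_n(K̄)|_{Γ_{K_v}} → μ_N(K̄)|_{Γ_{K_v}}` of discrete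
`Γ_{K_v}`-modules lying over the inclusion of roots of unity (`muVal (f x) = muVal x`) induces an INJECTIVE map
`H²(K_v, μ_n) → H²(K_v, μ_N)`: composed with `H²(K_v, μ_N) ↪ H²(K_v, K̄_vˣ) = Br(K_v)` (`cohomologyMap_muPlaceIso_kummer_injective`,
door-c6) it is the injective `H²(K_v, μ_n) ↪ Br(K_v)` (`kummerι_n = kummerι_N ∘ (μ_n ⊆ μ_N)`).  No local invariant map and no
compatibility of invariants across levels is used.  Consumer: the torsion-freeness of the value tower `H²(K_v, A_{m,j}(1))` of
Howard's induced local pairings in the upward direction (`Howard2004/DualityDatumValueMapTwoInjectiveProofs`, cell `pub/bsd-print-x9`).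
BSD is not proved by any of this.

References: [SerreGaloisCohomology1997] II §1.2 (Kummer theory, Hilbert 90); [SerreLocalFields1979] XIII §3; [MilneADT2006] I §1.
-/

set_option autoImplicit false

noncomputable section

open CategoryTheory Function NumberField IsDedekindDomain Field
open scoped ContRepresentation NumberField

namespace Literature.NumberTheory.GaloisRepresentations

open DiscreteGaloisModule

variable {K : Type} [Field K] [NumberField K]

/-- **`H²(K_v, μ_n) → H²(K_v, μ_N)` is injective on local classes** for any morphism over the inclusion `μ_n ⊆ μ_N` (`n ∣ N`), at
every place `v`: Kummer injectivity into `Br(K_v)` for `μ_n` factors through it.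
[cite: SerreGaloisCohomology1997, Ch. II §1.2 (Hilbert 90, H²(k, μ_n) = Br(k)[n])] [cite: SerreLocalFields1979, XIII §3] -/
theorem cohomologyMap_two_injective_of_muVal_eq (v : Place K) (n N : ℕ) [NeZero n] [NeZero N]
    (f : ((mu K n).toLocal v).toTopRep ⟶ ((mu K N).toLocal v).toTopRep)
    (hf : ∀ x : MuCarrier K n, muVal K N (f.hom x) = muVal K n x) :
    Injective (cohomologyMap f 2) := by
  haveI : CompactSpace (absoluteGaloisGroup (Place.Completion v)) := absoluteGaloisGroup_compactSpace _
  have hcomp : ∀ z : galoisCohomology ((mu K n).toLocal v) 2,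
      cohomologyMap ((HomDual.muPlaceIso v n).hom ≫ kummerι (Place.Completion v) n) 2 z =
        cohomologyMap ((HomDual.muPlaceIso v N).hom ≫ kummerι (Place.Completion v) N) 2 (cohomologyMap f 2 z) := fun z ↦
    map_comp_apply_of (ContinuousMonoidHom.id _) (ContinuousMonoidHom.id _) (ContinuousMonoidHom.id _) (fun _ => rfl)
      (resIdHom f) (resIdHom ((HomDual.muPlaceIso v N).hom ≫ kummerι (Place.Completion v) N))
      (resIdHom ((HomDual.muPlaceIso v n).hom ≫ kummerι (Place.Completion v) n)) (fun x ↦ by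
        apply unitsVal_injective
        apply Units.ext
        change ((muVal (Place.Completion v) n (muTransfer K (Place.Completion v) n x) : (AlgebraicClosure (Place.Completion v))ˣ) :
            AlgebraicClosure (Place.Completion v)) =
          (muVal (Place.Completion v) N (muTransfer K (Place.Completion v) N (f.hom x)) : (AlgebraicClosure (Place.Completion v))ˣ)
        rw [muVal_muTransfer, muVal_muTransfer, hf]) 2 z
  intro z z' h
  apply HomDual.cohomologyMap_muPlaceIso_kummer_injective v n
  rw [hcomp, hcomp, h]

end Literature.NumberTheory.GaloisRepresentations

/-! ## §2 Howard's value groups: `H²(K_v, φ(1)) : H²(K_v, R₁(1)) → H²(K_v, R₂(1))` is injective when the characters of `R₁(1)`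
lift along `φ` through `μ_{p^a} ⊆ μ_{p^b}` -/

namespace Literature.NumberTheory.GaloisCohomology.Howard2004.DualityDatum

open Literature.NumberTheory.GaloisRepresentations Literature.NumberTheory.GaloisRepresentations.DiscreteGaloisModule

variable {K : Type} [Field K] [NumberField K]

variable {M₁ : Type} [AddCommGroup M₁] [TopologicalSpace M₁] [DiscreteTopology M₁]
  {M₂ : Type} [AddCommGroup M₂] [TopologicalSpace M₂] [DiscreteTopology M₂]
  {R₁ : Type} [CommRing R₁] [Module R₁ M₁] [TopologicalSpace R₁] [DiscreteTopology R₁]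
  {R₂ : Type} [CommRing R₂] [Module R₂ M₂] [TopologicalSpace R₂] [DiscreteTopology R₂]
  {p : ℕ} [Fact p.Prime] [Algebra ℤ_[p] R₁] [Algebra ℤ_[p] R₂] {cd : ConjugationDatum K}
  {ρ₁ : DiscreteGaloisModule K M₁} {ρ₂ : DiscreteGaloisModule K M₂}

/-- **Injectivity of `H²(K_v, φ(1))` by character lifting.**  Let `D₁`, `D₂` be duality data over `R₁`, `R₂`, `φ : R₁ → R₂`
additive intertwining the Tate twists, `(λ₁, exp₁)` readout data at level `p^a` for `R₁` with a DUALIZING family `(r_i)`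
(`x ↦ (exp₁ λ₁(r_i x))_i` bijective), `(λ₂, exp₂)` readout data at level `p^b` for `R₂`, and suppose every character
`exp₁ ∘ λ₁ ∘ (r_i ·)` of `R₁(1)` LIFTS along `φ` through a morphism `incl : μ_{p^a}| → μ_{p^b}|` over the inclusion of roots of unity:
`incl (exp₁ λ₁(r_i x)) = exp₂ λ₂(r′_i φ(x))`.  Then `H²(K_v, φ(1))` is injective at every place `v` (a class killed by it has all
its character readings killed by the injective `H²(K_v, μ_{p^a}) → H²(K_v, μ_{p^b})`, §1, hence vanishes by family detection).
For Howard's tower: `φ = ×p^{b−a} : A_{m,a} ↪ A_{m,b}` — «the value tower `H²(K_v, A_{m,•}(1))` has torsion-free limit», upward.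
[cite: Howard2004HeegnerKolyvagin, §1.3 H.4 and §1.6 (arXiv p. 7 L78–82, p. 11 L33–38)] [cite: SerreGaloisCohomology1997, II §1.2] -/
theorem cohomologyMap_two_injective_of_character_lift (D₁ : DualityDatum p cd ρ₁ R₁) (D₂ : DualityDatum p cd ρ₂ R₂)
    {a b : ℕ} (lam₁ : R₁ →+ ZMod (p ^ a))
    (hlam₁ : ∀ (z : ℤ_[p]) (r : R₁), lam₁ (algebraMap ℤ_[p] R₁ z * r) = PadicInt.toZModPow a z * lam₁ r)
    (exp₁ : ZMod (p ^ a) →+ MuCarrier K (p ^ a))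
    (hexp₁ : ∀ (g : absoluteGaloisGroup K) (x : ZMod (p ^ a)), exp₁ (cyclotomicCharacterModPow K p a g * x) = mu K (p ^ a) g (exp₁ x))
    (lam₂ : R₂ →+ ZMod (p ^ b))
    (hlam₂ : ∀ (z : ℤ_[p]) (r : R₂), lam₂ (algebraMap ℤ_[p] R₂ z * r) = PadicInt.toZModPow b z * lam₂ r)
    (exp₂ : ZMod (p ^ b) →+ MuCarrier K (p ^ b))
    (hexp₂ : ∀ (g : absoluteGaloisGroup K) (x : ZMod (p ^ b)), exp₂ (cyclotomicCharacterModPow K p b g * x) = mu K (p ^ b) g (exp₂ x))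
    (φ : R₁ →+ R₂) (hφ : ∀ (g : absoluteGaloisGroup K) (x : R₁), φ (D₁.twistOne g x) = D₂.twistOne g (φ x))
    {ι : Type} [Finite ι] (r : ι → R₁) (hbij : Bijective fun x : R₁ => fun i : ι => exp₁ (lam₁ (r i * x))) (r' : ι → R₂)
    (v : Place K)
    (incl : ((mu K (p ^ a)).toLocal v).toTopRep ⟶ ((mu K (p ^ b)).toLocal v).toTopRep)
    (hincl : ∀ x : MuCarrier K (p ^ a), muVal K (p ^ b) (incl.hom x) = muVal K (p ^ a) x)
    (hchar : ∀ (i : ι) (x : R₁), incl.hom (exp₁ (lam₁ (r i * x))) = exp₂ (lam₂ (r' i * φ x))) :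
    Injective (ContinuousRep.cohomologyMap (D₁.twistOne.toLocal v) (D₂.twistOne.toLocal v) φ
      continuous_of_discreteTopology (fun _ z => hφ _ z) 2) := by
  haveI : NeZero (p ^ a) := ⟨pow_ne_zero a (Fact.out : p.Prime).ne_zero⟩
  haveI : NeZero (p ^ b) := ⟨pow_ne_zero b (Fact.out : p.Prime).ne_zero⟩
  haveI : CompactSpace (absoluteGaloisGroup (Place.Completion v)) := absoluteGaloisGroup_compactSpace _
  let γ : (D₁.twistOne.toLocal v).toTopRep ⟶ (D₂.twistOne.toLocal v).toTopRep :=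
    TopRep.ofHom ⟨⟨φ.toIntLinearMap, continuous_of_discreteTopology⟩, fun _ => ContinuousLinearMap.ext fun z => hφ _ z⟩
  -- the character squares: `H²(exp₂ λ₂ r′ᵢ) (H²(φ) q) = H²(incl) (H²(exp₁ λ₁ rᵢ) q)`
  have hsq : ∀ (i : ι) (q : galoisCohomology (D₁.twistOne.toLocal v) 2),
      cohomologyMap (D₂.expLamLocalHom (lamMul lam₂ (r' i)) (lamMul_semilinear lam₂ hlam₂ (r' i)) exp₂ hexp₂ v) 2
          (cohomologyMap γ 2 q) =
        cohomologyMap incl 2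
          (cohomologyMap (D₁.expLamLocalHom (lamMul lam₁ (r i)) (lamMul_semilinear lam₁ hlam₁ (r i)) exp₁ hexp₁ v) 2 q) := by
    intro i q
    have h := map_comp_apply_of (ContinuousMonoidHom.id _) (ContinuousMonoidHom.id _) (ContinuousMonoidHom.id _)
      (fun _ => rfl) (resIdHom γ)
      (resIdHom (D₂.expLamLocalHom (lamMul lam₂ (r' i)) (lamMul_semilinear lam₂ hlam₂ (r' i)) exp₂ hexp₂ v))
      (resIdHom (D₁.expLamLocalHom (lamMul lam₁ (r i)) (lamMul_semilinear lam₁ hlam₁ (r i)) exp₁ hexp₁ v ≫ incl))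
      (fun x ↦ hchar i x) 2 q
    exact h.symm.trans (cohomologyMap_comp_apply _ incl 2 q)
  have hI := cohomologyMap_two_injective_of_muVal_eq v (p ^ a) (p ^ b) incl hincl
  refine (injective_iff_map_eq_zero _).2 fun q hq ↦ ?_
  have hq' : cohomologyMap γ 2 q = 0 := hq
  refine D₁.eq_zero_of_forall_cohomologyMap_expLam_lamMul_eq_zero lam₁ hlam₁ exp₁ hexp₁ r hbij v q fun i ↦ hI ?_
  rw [← hsq, hq', map_zero, map_zero]

end Literature.NumberTheory.GaloisCohomology.Howard2004.DualityDatum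

end
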